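import Summits.AtomisticToContinuum.Crystallization.Theses.SpectralChargeLedger
import Summits.AtomisticToContinuum.Crystallization.Theorems.ShellsToLayers.Negative.UniformTauLattice
import Summits.AtomisticToContinuum.Crystallization.Theorems.ShellsToLayers.Negative.UniformTauNoWindow
import Summits.AtomisticToContinuum.Crystallization.Theorems.ShellsToLayers.Negative.UniformTauFalse

/-!
# Disproof of `ShellsToLayers` (stmt-AtomisticToContinuum-17254) — findings: NO KILL (the crux is a theorem); the quantifier order `∀ R ε ∃ τ` is certified load-bearing

Standing disprover's work file (refuter `cdisprove-stmt-AtomisticToContinuum-17254`, cycle 1,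
2026-08-17). Crux: `Summit.AtomisticToContinuum.Crystallization.Theses.SpectralChargeLedger.ShellsToLayers`
(route `route-AtomisticToContinuum-SpectralChargeLedger`, rank 3).

## Status of the crux: PROVED (no disproof exists)
The strategist's line `blowup-slot-layering` closes the crux by name with NO sorry:
`Cruxes/ShellsToLayers/Lines/blowup_slot_layering_support.lean`,
`ShellsToLayersBlowup.shellsToLayers_proof : SpectralChargeLedger.ShellsToLayers` — re-checked by
this seat on the farm 2026-08-17: rc 0, 0 sorries, 0 warnings, axioms
`{propext, Classical.choice, Quot.sound}`. Its stubs are landing as Theorems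
(`…ShellsToLayersGoodOfLimit` p165637, `…ShellsToLayersExactify` p166074; `stub_exactSlotLayering`,
`stub_templateShells` in flight). Consequently every attack below is on the HYPOTHESES / QUANTIFIER
STRUCTURE (what any proof must use), not on the statement.

## (a) Load-bearing analysis
1. **Quantifier order `∀ R ε, ∃ τ R'` — LOAD-BEARING, CERTIFIED.** `ShellsToLayersUniformTau`
   (below: the crux verbatim with `∃ τ R' : ℝ, 0 < τ ∧ τ ≤ 1 ∧` moved in front of
   `∀ R ε : ℝ, 0 < ε →`) is FALSE: `shellsToLayersUniformTau_false`, kernel-checked, proof landed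
   under `Theorems/ShellsToLayers/Negative/` (`UniformTauLattice` p167168, `UniformTauNoWindow`
   p167190, `UniformTauFalse`). Witness: `a₀ = 1`, `h₀ = √(2/3)`, `δ = 1/2`; given `τ, R'` take the
   `λ = 1 − τ/40`-compressed ideal fcc chunk `λ • (fcc ∩ B̄(0, max R' 0/λ + 2))`: every site within
   `R'` of the centre is `τ`-good (fcc branch, identity isometry, bijection `z ↦ λ⁻¹(z − y_j)`;
   uses that ideal fcc is a lattice with integer squared norms `i²+j²+k²+ij+jk+ki`, so its vectors
   of squared norm `< 2` are `0` and the twelve units), yet at `(R, ε) = (10, τ/160)` no window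
   exists: two in-layer neighbours of ANY layered set `S` of the window format at distance exactly
   `1` near the origin would be `ε`-matched to two chunk points at distance `λD`, `D` an fcc
   distance, `|λD − 1| ≤ 2ε` ⇒ `1 < D < √2`, impossible. MORAL for provers: `τ` must be
   `O(ε a₀ / R)` (the witness kills any `τ ≥ 160 ε` at `R = 10 a₀`); a fixed-tolerance local
   criterion cannot give the window — compactness in `τ` (or an effective `τ(R, ε) → 0`) is forced,
   as the line's contrapositive local-rubber compactness does.
2. **`R'` after `R` — load-bearing (trivial, informal).** With `R'` fixed before `R`: the exact
   ideal fcc ball `fcc ∩ B̄(0, R' + 2)` is good at every site within `R'` of the centre, but for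
   `R ≥ 2R' + 10` condition (1) of the window fails (the layered set has points of norm `≤ R` farther
   than `ε` from the finite chunk, wherever `t` puts it). Not formalised (no information content).
3. **`δ`-separation — NOT load-bearing (information for provers).** A `τ`-good site has its twelve
   neighbours at mutual/central distances `≥ min(a₀, b) − 2τ` and NOTHING else in its open
   `13/10·a₀`-ball; every site within `R'` of `i` is good, so the configuration is automatically
   `0.9 a₀`-separated on `B(y_i, R')` for `τ ≤ a₀/25`; points outside never enter a shell or the
   window. The crux with the hypothesis `∀ i j, i ≠ j → δ ≤ dist (y i) (y j)` deleted is still true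
   (positive strengthening; not this seat's to land).
4. **The `h₀`-box — coarsely load-bearing (informal).** For `h₀ ≥ 1.17 a₀` (`a₀²/3 + h₀² ≥ (1.3a₀)²`)
   the model shell `{p ∈ hcp/fccStacking a₀ h₀, p ≠ 0, ‖p‖ < 1.3a₀}` degenerates to the planar
   hexagon; then a single triangular layer is good everywhere and has no window (the layered set is
   3-dimensional on `B(0, 4a₀)`, the configuration planar). Inside the box `b = √(a₀²/3 + h₀²) ∈
   (0.9918, 1.0082)·a₀` and the model shell is the full twelve-shell (`laSlot_norm_band`,
   `templateShell_*_eq_range_slot*` in the line's support file), which is all the proof uses of the box.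
5. **`0 < ε` — load-bearing (informal).** At `ε = 0` the window is exact; one interior atom displaced
   by `τ/3` keeps every shell `τ`-good and breaks exact layering.
6. **Shell radius `13/10`** must lie strictly between `b_max ≈ 1.0082 a₀` and the second fcc/hcp
   distance `√2 a₀·(1 − O(τ))`; any `r ∈ (1.01, 1.40)·a₀` would do. Not load-bearing beyond that.

## (b) Tightness
The window band `[39/50, 17/20]·a₀` for height increments strictly contains the box's
`h₀ ∈ [0.8065, 0.8265]·a₀`; the proof produces `z m = m h₀` — slack, not tight. The effective
dependence `τ(R, ε)`: necessary `τ ≲ 16 ε a₀ / R` (item 1 scaled), conjectured sufficient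
`τ = c ε (a₀/R)²` (idea card `layer-germ-section-development`); the compactness proof gives no rate.

## (c) Natural strengthenings refuted
`ShellsToLayersUniformTau` (item 1). No other strengthening in the cone is live.

## (d) Targets
Payload `stuck_stubs = []`, `targets = []`. The line's registered stubs `stub_goodOfLimit`,
`stub_exactOfForallGood` are LANDED; `stub_exactSlotLayering`, `stub_templateShells` are proved
in the sorry-free skeleton (rev 3) — nothing to break. `stub_templateShells` drops `a₀ ≤ 1` from the
box: harmless (the identity `templateShell = range slotH/slotC` is invariant under the scaling
`(a₀, h₀, p) ↦ (s a₀, s h₀, s p)`, so truth on the box gives truth for all `a₀ ≥ 47/50`).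

## (e) Near-misses
None outstanding: the only sorried items of earlier drafts (items 2, 4, 5) were dropped as
information-free once the crux was confirmed proved; item 1 is fully proved.
-/

namespace Summit.AtomisticToContinuum.Crystallization.Cruxes.ShellsToLayers.Disproof

open Summit.AtomisticToContinuum.Crystallization.Theses

/-- **The uniform-tolerance strengthening** of the crux: `SpectralChargeLedger.ShellsToLayers`
verbatim with `∃ τ R' : ℝ, 0 < τ ∧ τ ≤ 1 ∧` moved in front of `∀ R ε : ℝ, 0 < ε →` ("one
tolerance serves every window scale"). FALSE (`shellsToLayersUniformTau_false`). [folklore] -/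
def ShellsToLayersUniformTau : Prop :=
  ∀ a₀ h₀ : ℝ, 47 / 50 ≤ a₀ → a₀ ≤ 1 → |h₀ - a₀ * Real.sqrt (2 / 3)| ≤ a₀ / 100 → ∀ δ : ℝ, 0 < δ → ∃ τ R' : ℝ, 0 < τ ∧ τ ≤ 1 ∧ ∀ R ε : ℝ, 0 < ε → ∀ (N : ℕ) (y : Fin N → EuclideanSpace ℝ (Fin 3)), (∀ i j : Fin N, i ≠ j → δ ≤ dist (y i) (y j)) → ∀ i : Fin N, (∀ j : Fin N, dist (y j) (y i) ≤ R' → (∃ A : EuclideanSpace ℝ (Fin 3) →ₗᵢ[ℝ] EuclideanSpace ℝ (Fin 3), (∃ e : ↥{z : EuclideanSpace ℝ (Fin 3) | z ∈ Set.range y ∧ z ≠ y j ∧ dist z (y j) < 13 / 10 * a₀} ≃ ↥{p : EuclideanSpace ℝ (Fin 3) | p ∈ Literature.MathematicalPhysics.StatisticalMechanics.hcpStacking a₀ h₀ ∧ p ≠ 0 ∧ ‖p‖ < 13 / 10 * a₀}, ∀ t : ↥{z : EuclideanSpace ℝ (Fin 3) | z ∈ Set.range y ∧ z ≠ y j ∧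 dist z (y j) < 13 / 10 * a₀}, dist ((t : EuclideanSpace ℝ (Fin 3)) - y j) (A ((e t : ↥{p : EuclideanSpace ℝ (Fin 3) | p ∈ Literature.MathematicalPhysics.StatisticalMechanics.hcpStacking a₀ h₀ ∧ p ≠ 0 ∧ ‖p‖ < 13 / 10 * a₀}) : EuclideanSpace ℝ (Fin 3))) ≤ τ) ∨ (∃ e : ↥{z : EuclideanSpace ℝ (Fin 3) | z ∈ Set.range y ∧ z ≠ y j ∧ dist z (y j) < 13 / 10 * a₀} ≃ ↥{p : EuclideanSpace ℝ (Fin 3) | p ∈ Literature.MathematicalPhysics.StatisticalMechanics.fccStacking a₀ h₀ ∧ p ≠ 0 ∧ ‖p‖ < 13 / 10 * a₀}, ∀ t : ↥{z : EuclideanSpace ℝ (Fin 3) | z ∈ Set.range y ∧ z ≠ y j ∧ dist z (y j) < 13 / 10 * a₀}, dist ((t : EuclideanSpace ℝ (Fin 3)) - y j) (A ((e t : ↥{p : EuclideanSpace ℝ (Fin 3) | p ∈ Literature.MathematicalPhysics.StatisticalMechanics.fccStacking a₀ h₀ ∧ p ≠ 0 ∧ ‖p‖ < 13 / 10 * a₀})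 : EuclideanSpace ℝ (Fin 3))) ≤ τ))) → ∃ (A : EuclideanSpace ℝ (Fin 3) →ₗᵢ[ℝ] EuclideanSpace ℝ (Fin 3)) (t : EuclideanSpace ℝ (Fin 3)) (s : ℤ → ℤ) (z : ℤ → ℝ), Literature.MathematicalPhysics.StatisticalMechanics.IsHaggSeq s ∧ (∀ m : ℤ, 39 / 50 * a₀ ≤ z (m + 1) - z m ∧ z (m + 1) - z m ≤ 17 / 20 * a₀) ∧ let S : Set (EuclideanSpace ℝ (Fin 3)) := {p | ∃ m i j : ℤ, p = A (((i : ℝ) • Literature.MathematicalPhysics.StatisticalMechanics.triangularVec₁ a₀) + ((j : ℝ) • Literature.MathematicalPhysics.StatisticalMechanics.triangularVec₂ a₀) + ((Literature.MathematicalPhysics.StatisticalMechanics.haggLabel s m : ℝ) • Literature.MathematicalPhysics.StatisticalMechanics.barlowOffset a₀) + (z m • Literature.MathematicalPhysics.StatisticalMechanics.layerNormal 1))}; (∀ p ∈ S, ‖p‖ ≤ R → ∃ k : Fin N, dist (y k + t) p ≤ ε) ∧ (∀ k : Fin N, ‖y k + t‖ ≤ R → ∃ p ∈ S, dist (y k +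 t) p ≤ ε)

/-- The strengthening implies the crux (pure quantifier shuffling), so its refutation is a
NEGATIVE LEMMA about the crux's quantifier order, not a refutation of the crux. [folklore] -/
theorem shellsToLayers_of_uniformTau (H : ShellsToLayersUniformTau) :
    SpectralChargeLedger.ShellsToLayers := by
  intro a₀ h₀ ha ha' hh δ hδ R ε hε
  obtain ⟨τ, R', hτ, hτ1, H'⟩ := H a₀ h₀ ha ha' hh δ hδ
  exact ⟨τ, R', hτ, hτ1, H' R ε hε⟩

/-- **Any proof of `ShellsToLayers` must let `τ` depend on `(R, ε)`**: the uniform-tolerance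
strengthening is false (compressed ideal fcc chunks; see the module docstring, item (a)1, and
`Theorems/ShellsToLayers/Negative/UniformTauFalse.lean`). [folklore] -/
theorem shellsToLayersUniformTau_false : ¬ ShellsToLayersUniformTau :=
  Summit.AtomisticToContinuum.Crystallization.Theorems.ShellsToLayers.Negative.shellsToLayers_false_uniformTau

end Summit.AtomisticToContinuum.Crystallization.Cruxes.ShellsToLayers.Disproof
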